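import Literature.NumberTheory.EllipticCurves.Sprung2017.SharpFlatPAdicLFunction
import Literature.NumberTheory.EllipticCurves.PlusMinusPAdicLFunctionProofs
import HarnessLib

/-!
# Sprung's ♯/♭ `p`-adic `L`-functions exist — proof of the named fact
# `Sprung2017.thm112_exists_isSprungPair` (Sprung 2017, Thm. 1.12 / Cor. 4.4, 4.5, 4.10, 4.11)

Topic `NumberTheory/EllipticCurves`; `Proofs` companion (theorems only, no new definition, no new
named fact) of `Literature.NumberTheory.EllipticCurves.Sprung2017.SharpFlatPAdicLFunction`, whose
named fact `Literature.NumberTheory.EllipticCurves.Sprung2017.thm112_exists_isSprungPair` — for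
`p` odd, `f` the newform of `E = W`, `E` with good reduction at `p` and `p ∣ a_p(E)`, there are
`L♯, L♭ ∈ Λ = ℤ_p⟦T⟧` with `θ_n ≡ −(u_n L♯ + v_n L♭) (mod ω_n)` for every `n ≥ 0`
(`IsSprungPair f p (a_p(E)) L♯ L♭`; congruences in `Λ ⊗ ℚ_p`) — is PROVED here:
`thm112_exists_isSprungPair_holds`. The case `a_p = 0` is Pollack's theorem (proved in the tree,
`pollack_exists_plusMinusPAdicLFunction_holds`); the present proof is uniform in `a_p` with
`p ∣ a_p` (for odd `p` the only further case is `p = 3`, `a_3 = ±3` — the cell's class X8).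

## The printed result and the route taken

F. Sprung, Algebra & Number Theory 11 (2017) 885–928 (= arXiv:1601.00010) [Sprung2017], §4,
constructs `(L♯, L♭)` as follows [corpus: paper:arxiv-1601.00010 p0016–p0017]: with
`𝒞_i = (a_p, Φ_{p^i}(1+T); −1, 0)`, `A = (a_p, p; −1, 0)`, `Ã = (a_p, 1; −1, 0)`,
"Proposition 4.1 (Tandem Lemma)", "Observation 4.2. Let `(Θ_n)_n` be a queue sequence … Then for
`n ≥ 2`, we have `π(Θ_n, νΘ_{n−1}) = (Θ_{n−1}, νΘ_{n−2})A`", "Proposition 4.3" (the second entry of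
`(Θ_n, νΘ_{n−1})Y_{n'−n}` vanishes at `ζ_{p^{n'}} − 1`) and "Corollary 4.4. Let `(Θ_n)_n` be a
queue sequence. Then `(Θ_n, νΘ_{n−1}) = Υ_n 𝒞_1⋯𝒞_n Ã⁻¹` for some `Υ_n ∈ Λ_n^{⊕2}`"; then
(Cor. 4.5, "Proposition (yeah)": `𝔐 = lim 𝔐_n = 0` for supersingular `p` since
`𝔐_n ⊂ p^{ord_p(α)(N+1)} Λ_n^{⊕2}`, and the proof of Thm. 1.12) the vectors are made to converge
through the Riemann sums of `L_p(f, α, T)`, `L_p(f, β, T)` and the matrix `𝓛og_{α,β}`; Cor. 4.10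
gives integrality for `a_p ≢ 1 (mod p)`. The tree has no supersingular `L_p(f, α, T)` (design
notes of `PAdicLFunction.lean`, `PlusMinusPAdicLFunction.lean`), and the fact is vendored in the
INTRINSIC first-column form (module docstring of `SharpFlatPAdicLFunction.lean`), so — exactly as
for Pollack's theorem in `PlusMinusPAdicLFunctionProofs.lean` — the limit is taken ALGEBRAICALLY
inside `Λ`, from the Mazur–Tate elements alone:

1. (§2–§3, `cyclotomicOmega_dvd_threeTerm`) **the three-term relation with the `a_p`-term**
   (Mazur–Tate–Teitelbaum 1986 §I.10 (10.2); Sprung's "queue sequence", Def. 1.7 / Example 1.8):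
   `ω_{n+1} ∣ θ_{n+2} − a_p θ_{n+1} + Φ_{p^{n+1}}(1+T) θ_n` in `ℚ[T]`, from the Hecke relation
   `∑_{j<p} [(r+j)/p]⁺ = a_p[r]⁺ − [pr]⁺` (`intCast_mul_ratPlusSymbol`, PROVED in the tree) summed
   over the fibres of `(ℤ/p^{n+2+e₀})^× → (ℤ/p^{n+1+e₀})^×` (the `a_p = 0` case is
   `cyclotomicOmega_dvd_mazurTateElement_add` of the Pollack file);
2. (§4) **`p`-integrality** of the symbols `[a/p^k]⁺_f` for `a_p ≢ 1 (mod p)` (Eisenstein number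
   `a_p − p − 1`, a `p`-adic unit; `norm_ratPlusSymbol_le_one` of
   `PAdicLFunctionIntegralityProofs`), so the `θ_n` lift to `Θ_n ∈ ℤ_p[T]` and the three-term
   quotients `c_n` (`Θ_{n+2} − a_p Θ_{n+1} + Φ_{p^{n+1}}(1+T) Θ_n = ω_{n+1} c_n`) are integral
   (monic descent);
3. (§5) **the Wronskian identities** for the recursion polynomials `u_n = sharpPoly`,
   `v_n = flatPoly` (first column of `M_n = 𝒞_1⋯𝒞_n Ã⁻¹`): `u_{n+1} v_n − v_{n+1} u_n =
   ∏_{1≤i≤n} Φ_{p^i}(1+T) = ω_n/T` (`= det M_n / det` — `det 𝒞_i = Φ_{p^i}(1+T)`, `det Ã = 1`), and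
   `v_m u_{m+j} − u_m v_{m+j} = (ω_m/T) · w_j` with `w_j` again a solution of the recursion; and
   **the orders** `u_n, v_n, w_n ∈ (p, T)^{⌊n/2⌋}` when `p ∣ a_p` (each step of the recursion
   multiplies by `a_p ∈ (p)` or by some `Φ_{p^k}(1+T)`, constant term `p`) — this is the content of
   Sprung's `𝔐_n ⊂ p^{ord_p(α)(N+1)} Λ_n^{⊕2}`;
4. (§7, `exists_integral_isSprungPair`) **the approximants** `Y_n := (Θ_1, Θ_0) +
   T ∑_{k<n} c_k (v_{k+1}, −u_{k+1}) ∈ ℤ_p[T]²` satisfy, EXACTLY, `Y_n · (u_{n+1}, v_{n+1}) = Θ_{n+1}`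
   and `Y_n · (u_n, v_n) = Θ_n` (induction on `n` with the three-term relation and the Wronskian;
   this is Cor. 4.4 `(Θ_n, νΘ_{n−1}) = Υ_n M_n` with an explicit compatible choice of the `Υ_n`, which
   replaces the Tandem Lemma), and `Y_{m+M} · (u_m, v_m) = Θ_m − ω_m G_{m,M}` with
   `G_{m,M+1} − G_{m,M} = c_{m+M} w_{M+1}`; by 3 the steps of `Y_n` and of `G_{m,·}` lie in
   `(p,T)^{⌊n/2⌋}`, so (§6, `ℤ_p` complete) they converge coefficientwise in `Λ`, and
   `(L♯, L♭) := −lim Y_n` satisfies `θ_m + u_m L♯ + v_m L♭ ∈ ω_m Λ` for every `m` — integrally,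
   i.e. with exponent `0` in `IsCongrModOmega`;
5. (§8) assembly from `IsNewformOf W f` (`p ∤ N`, `a_p(f) = a_p(E)`:
   `not_dvd_level_of_isNewformOf`, `cuspCoeff_eq_frobeniusTrace_of_isNewformOf_holds`).

NOT proved here (and not part of the fact): uniqueness of `(L♯, L♭)` (Sprung, Thm. 1.12, through
`𝓛og_{α,β}`), non-vanishing (Conjecture 4.12 of the source for `a_p ≠ 0`), the factorisation
`(L_α, L_β) = (L♯, L♭) 𝓛og_{α,β}`, the functional equation, `p = 2`, tame twists.
Everything used is a theorem of Mathlib or of the tree (`ratCast_ratPlusSymbol_holds`,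
`intCast_mul_ratPlusSymbol`, `norm_ratPlusSymbol_le_one`, `cuspCoeff_eq_frobeniusTrace_of_isNewformOf_holds`,
`not_dvd_level_of_isNewformOf`); no named fact is assumed. Net debt: −1.

## References

* F. Sprung, *On pairs of `p`-adic `L`-functions for weight-two modular forms*, Algebra Number
  Theory 11 (2017) 885–928: Def. 1.7, Example 1.8, Thm. 1.12, §4 (Prop. 4.1, Obs. 4.2, Prop. 4.3,
  Cor. 4.4, Cor. 4.5, Proposition "𝔐 = 0", proof of Thm. 1.12, Thm. 4.9, Cor. 4.10, Cor. 4.11)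
  [Sprung2017] [corpus: paper:arxiv-1601.00010 p0016–p0017].
* R. Pollack, Duke Math. J. 118 (2003) 523–558, Prop. 6.18 [Pollack2003] (the case `a_p = 0`).
* B. Mazur, J. Tate, J. Teitelbaum, Invent. Math. 84 (1986), §I.4 (4.2), §I.10 (10.2)
  [MazurTateTeitelbaum1986Invent].
* S. Lang, *Cyclotomic Fields I and II*, Ch. 5 §1 Thm. 1.1 (`Λ ≅ lim ℤ_p[T]/(h_n)`) [Lang1990].

## Design

Theorems only, `namespace Literature.NumberTheory.EllipticCurves.Sprung2017`; private helpers
for reindexing, orders, limits and descent (some verbatim from `PlusMinusPAdicLFunctionProofs`,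
where they are private); axioms of every theorem: `propext`, `Classical.choice`, `Quot.sound`.
The `p`-uniform parts of steps 2 and 4 are exposed with the integral lifts as a HYPOTHESIS
(`exists_lifts_threeTerm_of_lifts`, `exists_integral_isSprungPair_of_lifts`), so that the case
`p = 2` — where the symbols `[a/2^k]⁺` are only half-integral and integrality of `θ_n` comes from
the `Δ = {±1}` doubling instead of `norm_ratPlusSymbol_le_one` — is the companion file
`SharpFlatPAdicLFunctionTwoProofs` (cell `b2b-bsdres`, o1 lens-1 R-L1-G6-A) with no duplication.
-/

noncomputable section

open scoped MatrixGroups ModularForm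

open CongruenceSubgroup Polynomial Literature.NumberTheory.EllipticCurves.ModularForms

namespace Literature.NumberTheory.EllipticCurves.Sprung2017

/-! ## §1. Reindexing finite sums -/

section Reindex

variable {M : Type*} [AddCommMonoid M]

/-- Reindexing a sum over `ℤ/m` by the representatives `0 ≤ a.val < m`. [folklore] -/
private theorem sum_univ_zmod_val (m : ℕ) [NeZero m] (g : ℕ → M) :
    ∑ a : ZMod m, g a.val = ∑ k ∈ Finset.range m, g k := by
  refine Finset.sum_bij (fun a _ ↦ a.val) (fun a _ ↦ Finset.mem_range.mpr (ZMod.val_lt a))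
    (fun a _ b _ h ↦ ZMod.val_injective m h) (fun k hk ↦ ?_) (fun _ _ ↦ rfl)
  exact ⟨(k : ZMod m), Finset.mem_univ _, ZMod.val_cast_of_lt (Finset.mem_range.mp hk)⟩

/-- `∑_{k < a·b} g(k) = ∑_{j < a} ∑_{t < b} g(t + b·j)` (Euclidean division by `b`). [folklore] -/
private theorem sum_range_mul_eq_sum_sum (a b : ℕ) (g : ℕ → M) :
    ∑ k ∈ Finset.range (a * b), g k =
      ∑ j ∈ Finset.range a, ∑ t ∈ Finset.range b, g (t + b * j) := by
  rw [← Fin.sum_univ_eq_sum_range g (a * b),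
    ← finProdFinEquiv.sum_comp (fun x : Fin (a * b) ↦ g x), Fintype.sum_prod_type,
    ← Fin.sum_univ_eq_sum_range (fun j ↦ ∑ t ∈ Finset.range b, g (t + b * j)) a]
  refine Finset.sum_congr rfl fun j _ ↦ ?_
  rw [← Fin.sum_univ_eq_sum_range (fun t ↦ g (t + b * j)) b]
  refine Finset.sum_congr rfl fun t _ ↦ ?_
  rw [finProdFinEquiv_apply_val]

end Reindex

/-! ## §2. The Hecke relation at `p` along the fibres of `ℤ/p^{L+1} → ℤ/p^L` (general `a_p`) -/

section Fiber

variable {N : ℕ} [NeZero N] {f : CuspForm (Gamma0 N) 2} {p : ℕ} [Fact p.Prime]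

/-- **The Hecke relation at `p`** for the rational newform `f` (`IsNewform0`, rational
coefficients), `p ∤ N`, `a_p(f) = a_p`: `∑_{j<p} [(r + j)/p]⁺_f = a_p [r]⁺_f − [p r]⁺_f` for every
`r ∈ ℚ` (`intCast_mul_ratPlusSymbol`; Mazur–Tate–Teitelbaum 1986 §I.4 (4.2)).
[cite: MazurTateTeitelbaum1986Invent, §I.4 (4.2)] -/
theorem sum_range_ratPlusSymbol_div_eq_sub (hf0 : IsNewform0 f) (hQ : coeffField f = ⊥)
    (hpN : ¬ p ∣ N) {ap : ℤ} (hap : cuspCoeff f p = ap) (r : ℚ) :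
    ∑ j ∈ Finset.range p, ratPlusSymbol f ((r + j) / p) =
      (ap : ℚ) * ratPlusSymbol f r - ratPlusSymbol f (p * r) := by
  have hp : p.Prime := Fact.out
  have h := intCast_mul_ratPlusSymbol p hf0 hp hpN hap
    (fun r ↦ ratCast_ratPlusSymbol_holds hf0 hQ r) r
  rw [Fin.sum_univ_eq_sum_range (fun j ↦ ratPlusSymbol f ((r + j) / p)) p] at h
  linarith

/-- **The fibre sum** (general `a_p`): for `a mod p^L`, summing `[b/p^{L+1}]⁺_f` over the `p`
lifts `b` of `a` to `ℤ/p^{L+1}` gives `a_p [a/p^L]⁺_f − [p · a/p^L]⁺_f`: the lifts are `a + p^L j`,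
`j < p` (`filter_castHom_eq_image`), `(a + p^L j)/p^{L+1} = (a/p^L + j)/p`, and the Hecke relation
(`sum_range_ratPlusSymbol_div_eq_sub`) (Mazur–Tate–Teitelbaum 1986, §I.10 (10.2): the distribution
relation `π_{L+1/L} θ_{L+1} = a_p θ_L − ν θ_{L-1}`).
[cite: MazurTateTeitelbaum1986Invent, §I.10 Prop. (10.2)] -/
theorem sum_fiber_ratPlusSymbol_eq_sub (hf0 : IsNewform0 f) (hQ : coeffField f = ⊥)
    (hpN : ¬ p ∣ N) {ap : ℤ} (hap : cuspCoeff f p = ap) {L L' : ℕ} (hL : L' = L + 1)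
    (hdvd : p ^ L ∣ p ^ L') (a : ZMod (p ^ L)) :
    ∑ b ∈ Finset.univ.filter (fun b : ZMod (p ^ L') ↦ ZMod.castHom hdvd (ZMod (p ^ L)) b = a),
        ratPlusSymbol f ((b.val : ℚ) / (p : ℚ) ^ L') =
      (ap : ℚ) * ratPlusSymbol f ((a.val : ℚ) / (p : ℚ) ^ L) -
        ratPlusSymbol f (p * ((a.val : ℚ) / (p : ℚ) ^ L)) := by
  classical
  subst hL
  have hp : p.Prime := Fact.out
  haveI : NeZero p := ⟨hp.ne_zero⟩
  have hp0 : (p : ℚ) ≠ 0 := Nat.cast_ne_zero.mpr hp.ne_zero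
  have hinj : Function.Injective
      (fun j : Fin p ↦ ((a.val + p ^ L * (j : ℕ) : ℕ) : ZMod (p ^ (L + 1)))) := by
    intro j j' h
    have hv := congr_arg ZMod.val h
    simp only [val_classLift] at hv
    exact Fin.ext (Nat.eq_of_mul_eq_mul_left (pow_pos hp.pos L) (by omega))
  rw [filter_castHom_eq_image, Finset.sum_image fun j _ j' _ h ↦ hinj h]
  set x : ℚ := (a.val : ℚ) / (p : ℚ) ^ L with hx
  have hA : ∀ j : Fin p,
      ((a.val + p ^ L * (j : ℕ) : ℕ) : ℚ) / (p : ℚ) ^ (L + 1) = (x + j) / p := by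
    intro j
    rw [hx]
    push_cast
    field_simp
    ring
  have hH := sum_range_ratPlusSymbol_div_eq_sub hf0 hQ hpN hap x
  rw [← Fin.sum_univ_eq_sum_range (fun j ↦ ratPlusSymbol f ((x + j) / p)) p] at hH
  rw [← hH]
  refine Finset.sum_congr rfl fun j _ ↦ ?_
  rw [val_classLift, hA]

/-- The fibre of `ℤ/p^{L+1} → ℤ/p^L` over any class has exactly `p` elements. [folklore] -/
private theorem card_filter_castHom_eq {L L' : ℕ} (hL : L' = L + 1) (hdvd : p ^ L ∣ p ^ L')
    (a : ZMod (p ^ L)) :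
    (Finset.univ.filter (fun b : ZMod (p ^ L') ↦ ZMod.castHom hdvd (ZMod (p ^ L)) b = a)).card
      = p := by
  classical
  subst hL
  have hp : p.Prime := Fact.out
  have hinj : Function.Injective
      (fun j : Fin p ↦ ((a.val + p ^ L * (j : ℕ) : ℕ) : ZMod (p ^ (L + 1)))) := by
    intro j j' h
    have hv := congr_arg ZMod.val h
    simp only [val_classLift] at hv
    exact Fin.ext (Nat.eq_of_mul_eq_mul_left (pow_pos hp.pos L) (by omega))
  rw [filter_castHom_eq_image, Finset.card_image_of_injective _ hinj, Finset.card_univ,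
    Fintype.card_fin]

/-- **An orbit of `δ = γ^{p^{m}}` is a fibre.** Let `b₀` be a unit of `ℤ/p^{L+1}` and `δ` an
element of order `p` reducing to `1` modulo `p^L`; then `{b₀ δ^j : j < p}` is exactly the fibre of
`ℤ/p^{L+1} → ℤ/p^L` over `b₀ mod p^L` (both have `p` elements). [folklore] -/
private theorem image_mul_pow_eq_filter {L L' : ℕ} (hL : L' = L + 1) (hdvd : p ^ L ∣ p ^ L')
    {b₀ δ : ZMod (p ^ L')} (hb₀ : IsUnit b₀) (hδ : orderOf δ = p)
    (hδ1 : ZMod.castHom hdvd (ZMod (p ^ L)) δ = 1) :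
    Finset.univ.image (fun j : Fin p ↦ b₀ * δ ^ (j : ℕ)) =
      Finset.univ.filter (fun b : ZMod (p ^ L') ↦
        ZMod.castHom hdvd (ZMod (p ^ L)) b = ZMod.castHom hdvd (ZMod (p ^ L)) b₀) := by
  classical
  have hinj : Function.Injective (fun j : Fin p ↦ b₀ * δ ^ (j : ℕ)) := by
    intro j j' h
    have h1 : δ ^ (j : ℕ) = δ ^ (j' : ℕ) := hb₀.mul_right_inj.mp h
    have h2 := pow_injOn_Iio_orderOf (x := δ) (by rw [hδ]; exact j.2) (by rw [hδ]; exact j'.2) h1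
    exact Fin.ext h2
  refine Finset.eq_of_subset_of_card_le (fun b hb ↦ ?_) ?_
  · obtain ⟨j, -, rfl⟩ := Finset.mem_image.mp hb
    simp only [Finset.mem_filter, Finset.mem_univ, true_and, map_mul, map_pow, hδ1, one_pow,
      mul_one]
  · rw [card_filter_castHom_eq hL hdvd, Finset.card_image_of_injective _ hinj, Finset.card_univ,
      Fintype.card_fin]

/-- **Orbit form of the fibre sum**: with `b₀`, `δ` as in `image_mul_pow_eq_filter`,
`∑_{j<p} [b₀δ^j / p^{L+1}]⁺_f = a_p [(b₀ mod p^L)/p^L]⁺_f − [p · (b₀ mod p^L)/p^L]⁺_f`. [folklore] -/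
private theorem sum_range_ratPlusSymbol_orbit_eq_sub (hf0 : IsNewform0 f) (hQ : coeffField f = ⊥)
    (hpN : ¬ p ∣ N) {ap : ℤ} (hap : cuspCoeff f p = ap) {L L' : ℕ} (hL : L' = L + 1)
    (hdvd : p ^ L ∣ p ^ L') {b₀ δ : ZMod (p ^ L')} (hb₀ : IsUnit b₀) (hδ : orderOf δ = p)
    (hδ1 : ZMod.castHom hdvd (ZMod (p ^ L)) δ = 1) :
    ∑ j ∈ Finset.range p, ratPlusSymbol f (((b₀ * δ ^ j).val : ℚ) / (p : ℚ) ^ L') =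
      (ap : ℚ) * ratPlusSymbol f
          (((ZMod.castHom hdvd (ZMod (p ^ L)) b₀).val : ℚ) / (p : ℚ) ^ L) -
        ratPlusSymbol f
          (p * (((ZMod.castHom hdvd (ZMod (p ^ L)) b₀).val : ℚ) / (p : ℚ) ^ L)) := by
  classical
  have hinj : Function.Injective (fun j : Fin p ↦ b₀ * δ ^ (j : ℕ)) := by
    intro j j' h
    have h1 : δ ^ (j : ℕ) = δ ^ (j' : ℕ) := hb₀.mul_right_inj.mp h
    have h2 := pow_injOn_Iio_orderOf (x := δ) (by rw [hδ]; exact j.2) (by rw [hδ]; exact j'.2) h1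
    exact Fin.ext h2
  rw [← sum_fiber_ratPlusSymbol_eq_sub hf0 hQ hpN hap hL hdvd,
    ← image_mul_pow_eq_filter hL hdvd hb₀ hδ hδ1, Finset.sum_image fun j _ j' _ h ↦ hinj h,
    ← Fin.sum_univ_eq_sum_range (fun j ↦ ratPlusSymbol f (((b₀ * δ ^ j).val : ℚ) / (p : ℚ) ^ L')) p]

/-- `[p · x/p^{S+1}]⁺_f = [(x mod p^S)/p^S]⁺_f` for `x mod p^{S+1}`: `p·x/p^{S+1} = x/p^S` differs
from `(x mod p^S)/p^S` by an integer (`ratPlusSymbol_add_intCast_eq`). [folklore] -/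
private theorem ratPlusSymbol_mul_div_pow_eq {S I : ℕ} (hI : I = S + 1) (hdvd : p ^ S ∣ p ^ I)
    (x : ZMod (p ^ I)) :
    ratPlusSymbol f (p * ((x.val : ℚ) / (p : ℚ) ^ I)) =
      ratPlusSymbol f (((ZMod.castHom hdvd (ZMod (p ^ S)) x).val : ℚ) / (p : ℚ) ^ S) := by
  subst hI
  have hp : p.Prime := Fact.out
  haveI : NeZero (p ^ S) := ⟨pow_ne_zero _ hp.ne_zero⟩
  have hp0 : (p : ℚ) ≠ 0 := Nat.cast_ne_zero.mpr hp.ne_zero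
  have hval : (ZMod.castHom hdvd (ZMod (p ^ S)) x).val = x.val % p ^ S := by
    rw [ZMod.castHom_apply, ZMod.cast_eq_val, ZMod.val_natCast]
  set q : ℕ := x.val / p ^ S with hq
  set r : ℕ := x.val % p ^ S with hr
  have hx : (x.val : ℚ) = (r : ℚ) + (p : ℚ) ^ S * (q : ℚ) := by
    rw [hr, hq]
    exact_mod_cast (Nat.mod_add_div x.val (p ^ S)).symm
  have heq : (p : ℚ) * ((x.val : ℚ) / (p : ℚ) ^ (S + 1)) =
      (r : ℚ) / (p : ℚ) ^ S + ((q : ℤ) : ℚ) := by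
    rw [hx, Int.cast_natCast, pow_succ]
    field_simp
  rw [heq, ratPlusSymbol_add_intCast_eq, hval]

end Fiber

/-! ## §3. The three-term relation `θ_{n+2} ≡ a_p θ_{n+1} − Φ_{p^{n+1}}(1+T) θ_n (mod ω_{n+1})` -/

section ThreeTerm

variable {N : ℕ} [NeZero N] {f : CuspForm (Gamma0 N) 2} {p : ℕ} [Fact p.Prime]

omit [NeZero N] in
/-- The image of `θ_m` under a ring homomorphism `φ : ℚ[T] → R`:
`φ(θ_m) = ∑_η ∑_{k < p^m} φ([η γ^k / p^{m+e₀}]⁺) · φ(1+T)^k`. [folklore] -/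
private theorem map_mazurTateElement_eq {R : Type*} [CommRing R] (φ : ℚ[X] →+* R) (m : ℕ)
    [Fintype (rootsOfUnity (torsionOrder p) ℤ_[p])] :
    φ (mazurTateElement f p m) =
      ∑ w : rootsOfUnity (torsionOrder p) ℤ_[p], ∑ k ∈ Finset.range (p ^ m),
        φ (C (ratPlusSymbol f
          (((PadicInt.toZModPow (m + cyclotomicExponent p) ((w : ℤ_[p]ˣ) : ℤ_[p]) *
              (cyclotomicGenerator p : ZMod (p ^ (m + cyclotomicExponent p))) ^ k).val : ℚ) /
            (p : ℚ) ^ (m + cyclotomicExponent p)))) * φ (X + 1) ^ k := by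
  classical
  haveI : NeZero (p ^ m) := ⟨pow_ne_zero _ (Fact.out : p.Prime).ne_zero⟩
  rw [mazurTateElement, finsum_eq_sum_of_fintype, map_sum]
  refine Finset.sum_congr rfl fun w _ ↦ ?_
  rw [map_sum, ← sum_univ_zmod_val (p ^ m) (fun k ↦ φ (C (ratPlusSymbol f
          (((PadicInt.toZModPow (m + cyclotomicExponent p) ((w : ℤ_[p]ˣ) : ℤ_[p]) *
              (cyclotomicGenerator p : ZMod (p ^ (m + cyclotomicExponent p))) ^ k).val : ℚ) /
            (p : ℚ) ^ (m + cyclotomicExponent p)))) * φ (X + 1) ^ k)]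
  refine Finset.sum_congr rfl fun s _ ↦ ?_
  rw [map_mul, map_pow]

/-- **The three-term relation of the Mazur–Tate elements** (Mazur–Tate–Teitelbaum 1986, §I.10
(10.2): `π_{n+2/n+1}(θ_{n+2}) = a_p θ_{n+1} − ν_{n/n+1}(θ_n)`, with `ν_{n/n+1} =` multiplication by
`Φ_{p^{n+1}}(1+T) = ω_{n+1}/ω_n`; Sprung 2017, Def. 1.7 / Example 1.8: the Mazur–Tate elements
form a "queue sequence"): in `ℚ[T]`, for `a_p(f) = a_p ∈ ℤ`,
`ω_{n+1} ∣ θ_{n+2} − a_p θ_{n+1} + Φ_{p^{n+1}}(1+T) · θ_n`.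
Proof: in `ℚ[T]/(ω_{n+1})`, where `u = 1 + T` has `u^{p^{n+1}} = 1`, write `k < p^{n+2}` as
`k = t + p^{n+1} j`; the classes `η γ^t · (γ^{p^{n+1}})^j`, `j < p`, form the fibre of
`ℤ/p^{n+2+e₀} → ℤ/p^{n+1+e₀}` over `η γ^t`, so the Hecke relation sums them to
`a_p [η γ^t/p^{n+1+e₀}]⁺ − [η γ^t/p^{n+e₀}]⁺` (`sum_range_ratPlusSymbol_orbit_eq_sub`); the first
terms give `a_p θ_{n+1}`, and in the second `t = t' + p^n k` collects `∑_{k<p} u^{p^n k} = Φ_{p^{n+1}}(u)`.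
[cite: Sprung2017, Def. 1.7 and Example 1.8; MazurTateTeitelbaum1986Invent, §I.10 Prop. (10.2)] -/
theorem cyclotomicOmega_dvd_threeTerm (hf0 : IsNewform0 f) (hQ : coeffField f = ⊥)
    (hpN : ¬ p ∣ N) {ap : ℤ} (hap : cuspCoeff f p = ap) (n : ℕ) :
    (cyclotomicOmega p (n + 1)).map (Int.castRingHom ℚ) ∣
      mazurTateElement f p (n + 2) - C (ap : ℚ) * mazurTateElement f p (n + 1) +
        ((cyclotomic (p ^ (n + 1)) ℤ).comp (X + 1)).map (Int.castRingHom ℚ) *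
          mazurTateElement f p n := by
  classical
  have hp : p.Prime := Fact.out
  haveI := neZero_torsionOrder p
  haveI := Fintype.ofFinite (rootsOfUnity (torsionOrder p) ℤ_[p])
  -- the three levels `S = n + e₀ < I = n + 1 + e₀ < B = n + 2 + e₀`
  have hIS : n + 1 + (cyclotomicExponent p) = (n + (cyclotomicExponent p)) + 1 := by omega
  have hBI : n + 2 + (cyclotomicExponent p) = (n + 1 + (cyclotomicExponent p)) + 1 := by omega
  have hdvdIS : p ^ (n + (cyclotomicExponent p)) ∣ p ^ (n + 1 + (cyclotomicExponent p)) :=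
    pow_dvd_pow p (by omega)
  have hdvdBI : p ^ (n + 1 + (cyclotomicExponent p)) ∣ p ^ (n + 2 + (cyclotomicExponent p)) :=
    pow_dvd_pow p (by omega)
  -- the quotient ring `ℚ[T]/(ω_{n+1})` and `u = 1 + T`
  set ωQ : ℚ[X] := (cyclotomicOmega p (n + 1)).map (Int.castRingHom ℚ) with hωQ
  rw [← AdjoinRoot.mk_eq_zero]
  set π : ℚ[X] →+* AdjoinRoot ωQ := AdjoinRoot.mk ωQ with hπ
  set u : AdjoinRoot ωQ := π (X + 1) with hu
  have hu1 : u ^ p ^ (n + 1) = 1 := by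
    have hω : ((X : ℚ[X]) + 1) ^ p ^ (n + 1) - 1 = ωQ := by
      rw [hωQ, cyclotomicOmega, Polynomial.map_sub, Polynomial.map_pow, Polynomial.map_add,
        Polynomial.map_X, Polynomial.map_one]
    have h0 : π (((X : ℚ[X]) + 1) ^ p ^ (n + 1) - 1) = 0 := by
      rw [hω]
      exact AdjoinRoot.mk_self
    rw [map_sub, map_pow, map_one, sub_eq_zero] at h0
    rw [hu, h0]
  have hupow : ∀ a b : ℕ, u ^ (a + p ^ (n + 1) * b) = u ^ a := fun a b ↦ by
    rw [pow_add, pow_mul, hu1, one_pow, mul_one]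
  -- `γ` at the three levels
  have hγS : (cyclotomicGenerator p : ZMod (p ^ (n + (cyclotomicExponent p)))) ^ p ^ n = 1 := by
    rw [← orderOf_cyclotomicGenerator p n, pow_orderOf_eq_one]
  have hγI : (cyclotomicGenerator p :
      ZMod (p ^ (n + 1 + (cyclotomicExponent p)))) ^ p ^ (n + 1) = 1 := by
    rw [← orderOf_cyclotomicGenerator p (n + 1), pow_orderOf_eq_one]
  have hδord : orderOf ((cyclotomicGenerator p :
      ZMod (p ^ (n + 2 + (cyclotomicExponent p)))) ^ p ^ (n + 1)) = p := by
    rw [orderOf_pow' _ (pow_ne_zero _ hp.ne_zero), orderOf_cyclotomicGenerator p (n + 2),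
      Nat.gcd_eq_right (pow_dvd_pow p (by omega : n + 1 ≤ n + 2)), Nat.pow_div (by omega) hp.pos,
      show n + 2 - (n + 1) = 1 by omega, pow_one]
  have hδ1 : ZMod.castHom hdvdBI (ZMod (p ^ (n + 1 + (cyclotomicExponent p))))
      ((cyclotomicGenerator p :
        ZMod (p ^ (n + 2 + (cyclotomicExponent p)))) ^ p ^ (n + 1)) = 1 := by
    rw [map_pow, map_natCast, hγI]
  have hpdiv : ∀ v : ℚ, (p : ℚ) * (v / (p : ℚ) ^ (n + 1 + (cyclotomicExponent p))) =
      v / (p : ℚ) ^ (n + (cyclotomicExponent p)) := by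
    intro v
    have hp0 : (p : ℚ) ≠ 0 := Nat.cast_ne_zero.mpr hp.ne_zero
    rw [hIS, pow_succ]
    field_simp
  -- the value `T = ∑_η ∑_{k<p} ∑_{t'<p^n} [η γ^{t'}/p^{n+e₀}]⁺ u^{t'} (u^{p^n})^k = π(Φ θ_n)`
  set A : rootsOfUnity (torsionOrder p) ℤ_[p] → ℕ → ℚ := fun w k ↦ ratPlusSymbol f
    (((PadicInt.toZModPow (n + (cyclotomicExponent p)) ((w : ℤ_[p]ˣ) : ℤ_[p]) *
        (cyclotomicGenerator p : ZMod (p ^ (n + (cyclotomicExponent p)))) ^ k).val : ℚ) /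
          (p : ℚ) ^ (n + (cyclotomicExponent p))) with hA
  set T : AdjoinRoot ωQ := ∑ w : rootsOfUnity (torsionOrder p) ℤ_[p], ∑ k ∈ Finset.range p,
    ∑ t ∈ Finset.range (p ^ n), π (C (A w t)) * (u ^ t * (u ^ p ^ n) ^ k) with hT
  -- the value `Θ₁ = ∑_η ∑_{t<p^{n+1}} [η γ^{t}/p^{n+1+e₀}]⁺ u^{t} = π(θ_{n+1})`
  set A₁ : rootsOfUnity (torsionOrder p) ℤ_[p] → ℕ → ℚ := fun w k ↦ ratPlusSymbol f
    (((PadicInt.toZModPow (n + 1 + (cyclotomicExponent p)) ((w : ℤ_[p]ˣ) : ℤ_[p]) *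
        (cyclotomicGenerator p : ZMod (p ^ (n + 1 + (cyclotomicExponent p)))) ^ k).val : ℚ) /
          (p : ℚ) ^ (n + 1 + (cyclotomicExponent p))) with hA₁
  set Θ₁ : AdjoinRoot ωQ := ∑ w : rootsOfUnity (torsionOrder p) ℤ_[p],
    ∑ t ∈ Finset.range (p ^ (n + 1)), π (C (A₁ w t)) * u ^ t with hΘ₁
  -- `π(θ_n)`, `π(θ_{n+1})` and `π(Φ_{p^{n+1}}(1+T))`
  have hθn : π (mazurTateElement f p n) =
      ∑ w : rootsOfUnity (torsionOrder p) ℤ_[p], ∑ t ∈ Finset.range (p ^ n),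
        π (C (A w t)) * u ^ t := by
    rw [map_mazurTateElement_eq π n]
  have hθn1 : π (mazurTateElement f p (n + 1)) = Θ₁ := by
    rw [map_mazurTateElement_eq π (n + 1)]
  have hξ : π (((cyclotomic (p ^ (n + 1)) ℤ).comp (X + 1)).map (Int.castRingHom ℚ)) =
      ∑ k ∈ Finset.range p, (u ^ p ^ n) ^ k := by
    rw [cyclotomic_prime_pow_eq_geom_sum hp, Polynomial.sum_comp, Polynomial.map_sum, map_sum]
    refine Finset.sum_congr rfl fun k _ ↦ ?_
    rw [pow_comp, pow_comp, X_comp, Polynomial.map_pow, Polynomial.map_pow, Polynomial.map_add,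
      Polynomial.map_X, Polynomial.map_one, map_pow, map_pow]
  have hRHS : π (((cyclotomic (p ^ (n + 1)) ℤ).comp (X + 1)).map (Int.castRingHom ℚ)) *
      π (mazurTateElement f p n) = T := by
    rw [hξ, hθn, Finset.mul_sum]
    refine Finset.sum_congr rfl fun w _ ↦ ?_
    rw [Finset.sum_mul]
    refine Finset.sum_congr rfl fun k _ ↦ ?_
    rw [Finset.mul_sum]
    refine Finset.sum_congr rfl fun t _ ↦ ?_
    ring
  -- `π(θ_{n+2}) = a_p Θ₁ - T`
  have hLHS : π (mazurTateElement f p (n + 2)) = π (C (ap : ℚ)) * Θ₁ - T := by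
    rw [map_mazurTateElement_eq π (n + 2), ← hu]
    -- Step 1: `k = t + p^{n+1} j`, the `j`-sum is an orbit sum
    have h1 : ∀ w : rootsOfUnity (torsionOrder p) ℤ_[p],
        ∑ k ∈ Finset.range (p ^ (n + 2)),
          π (C (ratPlusSymbol f
            (((PadicInt.toZModPow (n + 2 + (cyclotomicExponent p)) ((w : ℤ_[p]ˣ) : ℤ_[p]) *
                (cyclotomicGenerator p :
                  ZMod (p ^ (n + 2 + (cyclotomicExponent p)))) ^ k).val : ℚ) /
              (p : ℚ) ^ (n + 2 + (cyclotomicExponent p))))) * u ^ k =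
        π (C (ap : ℚ)) * ∑ t ∈ Finset.range (p ^ (n + 1)), π (C (A₁ w t)) * u ^ t -
          ∑ t ∈ Finset.range (p ^ (n + 1)),
            π (C (ratPlusSymbol f
              (((PadicInt.toZModPow (n + 1 + (cyclotomicExponent p)) ((w : ℤ_[p]ˣ) : ℤ_[p]) *
                  (cyclotomicGenerator p :
                    ZMod (p ^ (n + 1 + (cyclotomicExponent p)))) ^ t).val : ℚ) /
                (p : ℚ) ^ (n + (cyclotomicExponent p))))) * u ^ t := by
      intro w
      rw [show p ^ (n + 2) = p * p ^ (n + 1) by ring, sum_range_mul_eq_sum_sum, Finset.sum_comm,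
        Finset.mul_sum, ← Finset.sum_sub_distrib]
      refine Finset.sum_congr rfl fun t _ ↦ ?_
      simp_rw [hupow t]
      rw [← Finset.sum_mul, ← map_sum, ← map_sum, ← mul_assoc, ← map_mul, ← sub_mul, ← map_sub,
        ← C_mul, ← C_sub]
      congr 3
      -- the orbit sum
      set b₀ : ZMod (p ^ (n + 2 + (cyclotomicExponent p))) :=
        PadicInt.toZModPow (n + 2 + (cyclotomicExponent p)) ((w : ℤ_[p]ˣ) : ℤ_[p]) *
          (cyclotomicGenerator p : ZMod (p ^ (n + 2 + (cyclotomicExponent p)))) ^ t with hb₀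
      have hb₀u : IsUnit b₀ :=
        ((Units.isUnit _).map _).mul ((isUnit_cyclotomicGenerator_cast p _).pow _)
      have horb := sum_range_ratPlusSymbol_orbit_eq_sub hf0 hQ hpN hap hBI hdvdBI hb₀u hδord hδ1
      have hcast : ZMod.castHom hdvdBI (ZMod (p ^ (n + 1 + (cyclotomicExponent p)))) b₀ =
          PadicInt.toZModPow (n + 1 + (cyclotomicExponent p)) ((w : ℤ_[p]ˣ) : ℤ_[p]) *
            (cyclotomicGenerator p : ZMod (p ^ (n + 1 + (cyclotomicExponent p)))) ^ t := by
        rw [hb₀, map_mul, map_pow, map_natCast, ZMod.castHom_apply,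
          PadicInt.cast_toZModPow _ _ (by omega)]
      rw [hcast, hpdiv] at horb
      rw [hA₁]
      dsimp only
      rw [← horb]
      refine Finset.sum_congr rfl fun j _ ↦ ?_
      rw [hb₀, pow_add (cyclotomicGenerator p :
          ZMod (p ^ (n + 2 + (cyclotomicExponent p)))) t (p ^ (n + 1) * j),
        pow_mul (cyclotomicGenerator p :
          ZMod (p ^ (n + 2 + (cyclotomicExponent p)))) (p ^ (n + 1)) j, mul_assoc]
    -- Step 2: `[p · x/p^{n+1+e₀}]⁺ = [(x mod p^{n+e₀})/p^{n+e₀}]⁺` and `t = t' + p^n k`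
    have h2 : ∀ w : rootsOfUnity (torsionOrder p) ℤ_[p],
        ∑ t ∈ Finset.range (p ^ (n + 1)),
          π (C (ratPlusSymbol f
            (((PadicInt.toZModPow (n + 1 + (cyclotomicExponent p)) ((w : ℤ_[p]ˣ) : ℤ_[p]) *
                (cyclotomicGenerator p :
                  ZMod (p ^ (n + 1 + (cyclotomicExponent p)))) ^ t).val : ℚ) /
              (p : ℚ) ^ (n + (cyclotomicExponent p))))) * u ^ t =
        ∑ k ∈ Finset.range p, ∑ t ∈ Finset.range (p ^ n),
          π (C (A w t)) * (u ^ t * (u ^ p ^ n) ^ k) := by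
      intro w
      rw [show p ^ (n + 1) = p * p ^ n by ring, sum_range_mul_eq_sum_sum]
      refine Finset.sum_congr rfl fun k _ ↦ ?_
      refine Finset.sum_congr rfl fun t _ ↦ ?_
      have hx : ∀ x : ZMod (p ^ (n + 1 + (cyclotomicExponent p))),
          ratPlusSymbol f ((x.val : ℚ) / (p : ℚ) ^ (n + (cyclotomicExponent p))) =
            ratPlusSymbol f (((ZMod.castHom hdvdIS
              (ZMod (p ^ (n + (cyclotomicExponent p)))) x).val : ℚ) /
                (p : ℚ) ^ (n + (cyclotomicExponent p))) := by
        intro x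
        rw [← ratPlusSymbol_mul_div_pow_eq hIS hdvdIS x, hpdiv]
      rw [hx, map_mul, map_pow, map_natCast, ZMod.castHom_apply,
        PadicInt.cast_toZModPow _ _ (by omega),
        pow_add (cyclotomicGenerator p : ZMod (p ^ (n + (cyclotomicExponent p)))) t (p ^ n * k),
        pow_mul (cyclotomicGenerator p : ZMod (p ^ (n + (cyclotomicExponent p)))) (p ^ n) k,
        hγS, one_pow, mul_one, pow_add u t (p ^ n * k), pow_mul u (p ^ n) k]
    simp_rw [h1, h2]
    rw [hT, hΘ₁, Finset.sum_sub_distrib, Finset.mul_sum]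
  rw [map_add, map_sub, map_mul, map_mul, hLHS, hRHS, hθn1]
  ring

end ThreeTerm

/-! ## §4. `p`-integrality of `θ_n` when `a_p ≢ 1 (mod p)` -/

section Integral

variable {N : ℕ} [NeZero N] {f : CuspForm (Gamma0 N) 2} {p : ℕ} [Fact p.Prime]

/-- **`p`-integrality of the symbols `[a/p^k]⁺_f` when `a_p ≢ 1 (mod p)`** (`p` odd, `p ∤ N`):
the Eisenstein multiple `(a_p − p − 1){∞, 0}` lies in `Λ_f`
(`sub_mul_modularSymbol_zero_mem_periodLattice`) and `p ∤ a_p − p − 1`, so `[a/p^k]⁺` is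
`p`-integral (`norm_ratPlusSymbol_le_one`). This is the integrality input of Sprung 2017,
Thm. 4.9 / Cor. 4.10 ("When `a_p ≢ 1 mod p`, `L_p^♯(E,ωⁱ,T)` and `L_p^♭(E,ωⁱ,T)` … are in `Λ`"),
in the tree's `Ω⁺_f`-normalisation (Stevens 1989 §4; Greenberg–Vatsal 2000 Prop. 3.7).
[cite: Sprung2017, Thm. 4.9 and Cor. 4.10] -/
theorem norm_ratPlusSymbol_div_pow_le_one_of_not_dvd (hp2 : p ≠ 2) (hf0 : IsNewform0 f)
    (hpN : ¬ p ∣ N) {ap : ℤ} (hap : cuspCoeff f p = ap) (hpa : ¬ (p : ℤ) ∣ ap - 1) (a k : ℕ) :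
    ‖((ratPlusSymbol f ((a : ℚ) / (p : ℚ) ^ k) : ℚ) : ℚ_[p])‖ ≤ 1 := by
  have hp : p.Prime := Fact.out
  have h0 : (((ap - p - 1 : ℤ) : ℂ)) * modularSymbol f 0 ∈ periodLattice f := by
    have h := sub_mul_modularSymbol_zero_mem_periodLattice hf0 hp hpN
    rw [hap] at h
    convert h using 2
    push_cast
    ring
  have hpn : ¬ (p : ℤ) ∣ ap - p - 1 := by
    intro h
    apply hpa
    have h2 : ap - 1 = (ap - p - 1) + p := by ring
    rw [h2]
    exact dvd_add h (dvd_refl (p : ℤ))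
  exact norm_ratPlusSymbol_le_one f hp2 hpn h0 (coprime_den_div_prime_pow hpN a k)

/-- **`θ_n ∈ ℤ_p[T]`** when `a_p ≢ 1 (mod p)`: the Mazur–Tate element has `p`-integral
coefficients, i.e. its image in `ℚ_p[T]` lifts to `ℤ_p[T]` (Sprung 2017, Cor. 4.10).
[cite: Sprung2017, Cor. 4.10] -/
theorem exists_map_eq_map_mazurTateElement_of_not_dvd (hp2 : p ≠ 2) (hf0 : IsNewform0 f)
    (hpN : ¬ p ∣ N) {ap : ℤ} (hap : cuspCoeff f p = ap) (hpa : ¬ (p : ℤ) ∣ ap - 1) (n : ℕ) :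
    ∃ Θ : ℤ_[p][X], Θ.map (algebraMap ℤ_[p] ℚ_[p]) =
      (mazurTateElement f p n).map (algebraMap ℚ ℚ_[p]) := by
  classical
  haveI := neZero_torsionOrder p
  haveI := Fintype.ofFinite (rootsOfUnity (torsionOrder p) ℤ_[p])
  rw [← Polynomial.mem_lifts, mazurTateElement, finsum_eq_sum_of_fintype, Polynomial.map_sum]
  refine Subsemiring.sum_mem _ fun w _ ↦ ?_
  rw [Polynomial.map_sum]
  refine Subsemiring.sum_mem _ fun s _ ↦ ?_
  rw [Polynomial.map_mul, Polynomial.map_pow, Polynomial.map_add, Polynomial.map_X,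
    Polynomial.map_one, Polynomial.map_C]
  refine Subsemiring.mul_mem _ ?_ (Subsemiring.pow_mem _
    (Subsemiring.add_mem _ (X_mem_lifts _) (Subsemiring.one_mem _)) _)
  set q : ℚ := ratPlusSymbol f
    (((PadicInt.toZModPow (n + cyclotomicExponent p) ((w : ℤ_[p]ˣ) : ℤ_[p]) *
        (cyclotomicGenerator p : ZMod (p ^ (n + cyclotomicExponent p))) ^ s.val).val : ℚ) /
      (p : ℚ) ^ (n + cyclotomicExponent p)) with hq
  have hnorm : ‖(q : ℚ_[p])‖ ≤ 1 :=
    norm_ratPlusSymbol_div_pow_le_one_of_not_dvd hp2 hf0 hpN hap hpa _ _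
  have heq : algebraMap ℚ ℚ_[p] q = algebraMap ℤ_[p] ℚ_[p] ⟨(q : ℚ_[p]), hnorm⟩ := by
    rw [eq_ratCast]
    rfl
  rw [heq]
  exact C_mem_lifts _ _

omit [NeZero N] in
/-- **Monic descent**: for `D, P ∈ ℤ_p[T]` with `D` monic, `D ∣ P` in `ℚ_p[T]` implies `D ∣ P` in
`ℤ_p[T]` (division with remainder by a monic polynomial commutes with base change). [folklore] -/
private theorem dvd_of_map_dvd_map {D P : ℤ_[p][X]} (hD : D.Monic)
    (h : D.map (algebraMap ℤ_[p] ℚ_[p]) ∣ P.map (algebraMap ℤ_[p] ℚ_[p])) : D ∣ P := by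
  rw [← modByMonic_eq_zero_iff_dvd hD]
  apply Polynomial.map_injective (algebraMap ℤ_[p] ℚ_[p]) (IsFractionRing.injective ℤ_[p] ℚ_[p])
  rw [Polynomial.map_modByMonic _ hD, Polynomial.map_zero]
  exact (modByMonic_eq_zero_iff_dvd (hD.map _)).mpr h

omit [NeZero N] in
/-- The two routes `ℤ[T] → ℚ[T] → ℚ_p[T]` and `ℤ[T] → ℤ_p[T] → ℚ_p[T]` agree. [folklore] -/
private theorem map_map_int_eq (q : ℤ[X]) :
    (q.map (Int.castRingHom ℚ)).map (algebraMap ℚ ℚ_[p]) =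
      (q.map (Int.castRingHom ℤ_[p])).map (algebraMap ℤ_[p] ℚ_[p]) := by
  rw [Polynomial.map_map, Polynomial.map_map,
    RingHom.ext_int ((algebraMap ℚ ℚ_[p]).comp (Int.castRingHom ℚ))
      ((algebraMap ℤ_[p] ℚ_[p]).comp (Int.castRingHom ℤ_[p]))]

/-- **The three-term relation in `ℤ_p[T]`, from integral lifts** (any prime `p`, `p ∤ N`): if
every `θ_n` lifts to some `Θ ∈ ℤ_p[T]`, there are lifts `Θ_n ∈ ℤ_p[T]` of the `θ_n` and
`c_n ∈ ℤ_p[T]` with `Θ_{n+2} − a_p Θ_{n+1} + Φ_{p^{n+1}}(1+T) Θ_n = ω_{n+1} · c_n` (monic descent of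
`cyclotomicOmega_dvd_threeTerm`; Sprung 2017, Def. 1.7 / Example 1.8). The integrality input is a
HYPOTHESIS here (`hlift`), so that the statement is uniform in `p`: at odd `p` it is supplied by
`exists_map_eq_map_mazurTateElement_of_not_dvd` (`a_p ≢ 1 (mod p)`, Cor. 4.10), at `p = 2` by the
`Δ = {±1}` doubling of the Mazur–Tate coefficients (companion file
`SharpFlatPAdicLFunctionTwoProofs`). [cite: Sprung2017, Def. 1.7, Example 1.8 and Cor. 4.10] -/
theorem exists_lifts_threeTerm_of_lifts (hf0 : IsNewform0 f) (hQ : coeffField f = ⊥)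
    (hpN : ¬ p ∣ N) {ap : ℤ} (hap : cuspCoeff f p = ap)
    (hlift : ∀ n, ∃ Θ : ℤ_[p][X], Θ.map (algebraMap ℤ_[p] ℚ_[p]) =
      (mazurTateElement f p n).map (algebraMap ℚ ℚ_[p])) :
    ∃ (Θ c : ℕ → ℤ_[p][X]),
      (∀ n, (Θ n).map (algebraMap ℤ_[p] ℚ_[p]) =
        (mazurTateElement f p n).map (algebraMap ℚ ℚ_[p])) ∧
      ∀ n, Θ (n + 2) - C (ap : ℤ_[p]) * Θ (n + 1) +
          ((cyclotomic (p ^ (n + 1)) ℤ).comp (X + 1)).map (Int.castRingHom ℤ_[p]) * Θ n =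
        (cyclotomicOmega p (n + 1)).map (Int.castRingHom ℤ_[p]) * c n := by
  classical
  choose Θ hΘ using hlift
  have hdvd : ∀ n, (cyclotomicOmega p (n + 1)).map (Int.castRingHom ℤ_[p]) ∣
      Θ (n + 2) - C (ap : ℤ_[p]) * Θ (n + 1) +
        ((cyclotomic (p ^ (n + 1)) ℤ).comp (X + 1)).map (Int.castRingHom ℤ_[p]) * Θ n := by
    intro n
    refine dvd_of_map_dvd_map ((monic_cyclotomicOmega p (n + 1)).map _) ?_
    have hmap : (Θ (n + 2) - C (ap : ℤ_[p]) * Θ (n + 1) +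
        ((cyclotomic (p ^ (n + 1)) ℤ).comp (X + 1)).map (Int.castRingHom ℤ_[p]) * Θ n).map
          (algebraMap ℤ_[p] ℚ_[p]) =
        (mazurTateElement f p (n + 2) - C (ap : ℚ) * mazurTateElement f p (n + 1) +
          ((cyclotomic (p ^ (n + 1)) ℤ).comp (X + 1)).map (Int.castRingHom ℚ) *
            mazurTateElement f p n).map (algebraMap ℚ ℚ_[p]) := by
      rw [Polynomial.map_add, Polynomial.map_sub, Polynomial.map_mul, Polynomial.map_mul,
        Polynomial.map_C, hΘ, hΘ, hΘ, ← map_map_int_eq, Polynomial.map_add, Polynomial.map_sub,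
        Polynomial.map_mul, Polynomial.map_mul, Polynomial.map_C]
      simp only [map_intCast]
    rw [← map_map_int_eq, hmap]
    exact Polynomial.map_dvd _ (cyclotomicOmega_dvd_threeTerm hf0 hQ hpN hap n)
  choose c hc using hdvd
  exact ⟨Θ, c, hΘ, hc⟩

/-- **The three-term relation in `ℤ_p[T]`**: for `p` odd, `p ∤ N`, `a_p ≢ 1 (mod p)` there are
`Θ_n ∈ ℤ_p[T]` lifting the `θ_n` and `c_n ∈ ℤ_p[T]` with
`Θ_{n+2} − a_p Θ_{n+1} + Φ_{p^{n+1}}(1+T) Θ_n = ω_{n+1} · c_n` (monic descent of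
`cyclotomicOmega_dvd_threeTerm`; Sprung 2017, Def. 1.7 / Example 1.8 with Cor. 4.10).
[cite: Sprung2017, Def. 1.7, Example 1.8 and Cor. 4.10] -/
theorem exists_lifts_threeTerm (hp2 : p ≠ 2) (hf0 : IsNewform0 f) (hQ : coeffField f = ⊥)
    (hpN : ¬ p ∣ N) {ap : ℤ} (hap : cuspCoeff f p = ap) (hpa : ¬ (p : ℤ) ∣ ap - 1) :
    ∃ (Θ c : ℕ → ℤ_[p][X]),
      (∀ n, (Θ n).map (algebraMap ℤ_[p] ℚ_[p]) =
        (mazurTateElement f p n).map (algebraMap ℚ ℚ_[p])) ∧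
      ∀ n, Θ (n + 2) - C (ap : ℤ_[p]) * Θ (n + 1) +
          ((cyclotomic (p ^ (n + 1)) ℤ).comp (X + 1)).map (Int.castRingHom ℤ_[p]) * Θ n =
        (cyclotomicOmega p (n + 1)).map (Int.castRingHom ℤ_[p]) * c n :=
  exists_lifts_threeTerm_of_lifts hf0 hQ hpN hap
    fun n ↦ exists_map_eq_map_mazurTateElement_of_not_dvd hp2 hf0 hpN hap hpa n

end Integral

/-! ## §5. The `(p, T)`-adic order of the recursion polynomials, and the Wronskians -/

section Order

variable {p : ℕ} [hp : Fact p.Prime]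

/-- Order `≥ 0` is no condition. [folklore] -/
private theorem pord_zero (P : ℤ_[p][X]) (i : ℕ) : (p : ℤ_[p]) ^ (0 - i) ∣ P.coeff i := by
  rw [Nat.zero_sub, pow_zero]
  exact one_dvd _

/-- Orders add under multiplication: if `p^{K-j} ∣ P_j` and `p^{K'-j} ∣ Q_j` for all `j` then
`p^{K+K'-j} ∣ (PQ)_j` (truncated subtraction). [folklore] -/
private theorem pord_mul {K K' : ℕ} {P Q : ℤ_[p][X]} (hP : ∀ i, (p : ℤ_[p]) ^ (K - i) ∣ P.coeff i)
    (hQ : ∀ i, (p : ℤ_[p]) ^ (K' - i) ∣ Q.coeff i) (i : ℕ) :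
    (p : ℤ_[p]) ^ (K + K' - i) ∣ (P * Q).coeff i := by
  rw [coeff_mul]
  refine Finset.dvd_sum fun x hx ↦ ?_
  obtain ⟨a, b⟩ := x
  have hab : a + b = i := Finset.HasAntidiagonal.mem_antidiagonal.mp hx
  calc (p : ℤ_[p]) ^ (K + K' - i) ∣ (p : ℤ_[p]) ^ (K - a) * (p : ℤ_[p]) ^ (K' - b) := by
        rw [← pow_add]
        exact pow_dvd_pow _ (by omega)
    _ ∣ P.coeff a * Q.coeff b := mul_dvd_mul (hP a) (hQ b)

/-- Right multiplication by anything keeps the order. [folklore] -/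
private theorem pord_mul_right {K : ℕ} {P : ℤ_[p][X]}
    (hP : ∀ i, (p : ℤ_[p]) ^ (K - i) ∣ P.coeff i) (Q : ℤ_[p][X]) (i : ℕ) :
    (p : ℤ_[p]) ^ (K - i) ∣ (P * Q).coeff i := by
  have h := pord_mul hP (pord_zero Q) i
  rwa [add_zero] at h

/-- Left multiplication by anything keeps the order. [folklore] -/
private theorem pord_mul_left {K : ℕ} {P : ℤ_[p][X]} (Q : ℤ_[p][X])
    (hP : ∀ i, (p : ℤ_[p]) ^ (K - i) ∣ P.coeff i) (i : ℕ) :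
    (p : ℤ_[p]) ^ (K - i) ∣ (Q * P).coeff i := by
  rw [mul_comm]
  exact pord_mul_right hP Q i

/-- Orders are monotone. [folklore] -/
private theorem pord_mono {K K' : ℕ} (hK : K' ≤ K) {P : ℤ_[p][X]}
    (hP : ∀ i, (p : ℤ_[p]) ^ (K - i) ∣ P.coeff i) (i : ℕ) :
    (p : ℤ_[p]) ^ (K' - i) ∣ P.coeff i :=
  (pow_dvd_pow _ (by omega)).trans (hP i)

/-- Differences keep the order. [folklore] -/
private theorem pord_sub {K : ℕ} {P Q : ℤ_[p][X]} (hP : ∀ i, (p : ℤ_[p]) ^ (K - i) ∣ P.coeff i)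
    (hQ : ∀ i, (p : ℤ_[p]) ^ (K - i) ∣ Q.coeff i) (i : ℕ) :
    (p : ℤ_[p]) ^ (K - i) ∣ (P - Q).coeff i := by
  rw [coeff_sub]
  exact dvd_sub (hP i) (hQ i)

/-- A constant in `(p)` has order `≥ 1`. [folklore] -/
private theorem pord_C {a : ℤ_[p]} (ha : (p : ℤ_[p]) ∣ a) (i : ℕ) :
    (p : ℤ_[p]) ^ (1 - i) ∣ (C a : ℤ_[p][X]).coeff i := by
  rcases Nat.eq_zero_or_pos i with rfl | hi
  · rwa [coeff_C_zero, Nat.sub_zero, pow_one]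
  · rw [coeff_C, if_neg hi.ne']
    exact dvd_zero _

/-- `Φ_{p^{k+1}}(1+T)` has order `≥ 1`: its constant term is `Φ_{p^{k+1}}(1) = p`. [folklore] -/
private theorem pord_cyclotomic (k : ℕ) (i : ℕ) :
    (p : ℤ_[p]) ^ (1 - i) ∣
      (((cyclotomic (p ^ (k + 1)) ℤ).comp (X + 1)).map (Int.castRingHom ℤ_[p])).coeff i := by
  rcases Nat.eq_zero_or_pos i with rfl | hi
  · rw [Nat.sub_zero, pow_one, coeff_map, coeff_zero_eq_eval_zero, eval_comp, eval_add, eval_X,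
      eval_one, zero_add, eval_one_cyclotomic_prime_pow, map_natCast]
  · rw [show 1 - i = 0 by omega, pow_zero]
    exact one_dvd _

/-- **The recursion polynomials lie in `(p, T)^{⌊n/2⌋}`** when `p ∣ a_p`: for any start
`x_0, x_1 ∈ ℤ[T]`, the solution `x_n` of `x_n = a_p x_{n−1} − Φ_{p^{n−1}}(1+T) x_{n−2}` has
`p^{⌊n/2⌋ − j} ∣ (x_n)_j` for all `j` (each step multiplies by `a_p ∈ (p)` or by `Φ_{p^k}(1+T)`,
constant term `p`). This is the convergence mechanism of Sprung 2017, proof of Thm. 1.12 via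
"Proposition (yeah)": `𝔐_n ⊂ p^{ord_p(α)(N+1)} Λ_n^{⊕2}` for supersingular `p`.
[cite: Sprung2017, §4 (Proposition "𝔐 = 0" and proof of Thm. 1.12)] -/
theorem pow_dvd_coeff_map_sprungSeq {ap : ℤ} (hap : (p : ℤ) ∣ ap) (x₀ x₁ : ℤ[X]) (n i : ℕ) :
    (p : ℤ_[p]) ^ (n / 2 - i) ∣ ((sprungSeq ap p x₀ x₁ n).map (Int.castRingHom ℤ_[p])).coeff i := by
  have hapZ : (p : ℤ_[p]) ∣ (ap : ℤ_[p]) := by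
    obtain ⟨k, hk⟩ := hap
    exact ⟨(k : ℤ_[p]), by rw [hk]; push_cast; ring⟩
  have key : ∀ n, (∀ i, (p : ℤ_[p]) ^ (n / 2 - i) ∣
        ((sprungSeq ap p x₀ x₁ n).map (Int.castRingHom ℤ_[p])).coeff i) ∧
      (∀ i, (p : ℤ_[p]) ^ ((n + 1) / 2 - i) ∣
        ((sprungSeq ap p x₀ x₁ (n + 1)).map (Int.castRingHom ℤ_[p])).coeff i) := by
    intro n
    induction n with
    | zero =>
      refine ⟨fun i ↦ ?_, fun i ↦ ?_⟩
      · rw [Nat.zero_div]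
        exact pord_zero _ i
      · rw [show (0 + 1) / 2 = 0 from rfl]
        exact pord_zero _ i
    | succ n ih =>
      refine ⟨ih.2, fun i ↦ ?_⟩
      rw [show n + 1 + 1 = n + 2 by ring, sprungSeq_add_two, Polynomial.map_sub,
        Polynomial.map_mul, Polynomial.map_mul, Polynomial.map_C, eq_intCast]
      refine pord_sub (fun i ↦ ?_) (fun i ↦ ?_) i
      · refine pord_mono (by omega) (pord_mul (pord_C hapZ) ih.2) i
      · have h := pord_mul (pord_cyclotomic (p := p) n) ih.1 i
        rwa [show 1 + n / 2 = (n + 2) / 2 by omega] at h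
  exact (key n).1 i

variable (p)

/-- `T · ∏_{i<n} Φ_{p^{i+1}}(1+T) = ω_n` (`cyclotomicOmega_succ`): the determinant
`∏_{i≤n} Φ_{p^i}(1+T) = det 𝒞_1⋯𝒞_n` of Sprung's matrices is `ω_n/T`.
[cite: Sprung2017, §4 (the matrices 𝒞_i, det 𝒞_i = Φ_{p^i}(1+T))] -/
theorem X_mul_prod_cyclotomic_comp_eq_cyclotomicOmega (n : ℕ) :
    X * ∏ i ∈ Finset.range n, (cyclotomic (p ^ (i + 1)) ℤ).comp (X + 1) = cyclotomicOmega p n := by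
  induction n with
  | zero => simp [cyclotomicOmega]
  | succ n ih => rw [Finset.prod_range_succ, ← mul_assoc, ih, cyclotomicOmega_succ]

variable {p}

omit hp in
/-- **The Wronskian of `(u_n)`, `(v_n)`**: `u_{n+1} v_n − v_{n+1} u_n = ∏_{1≤i≤n} Φ_{p^i}(1+T)`
(`= ω_n/T`), i.e. `det [e_{n+1} | e_n] = det 𝒞_1⋯𝒞_n · det Ã⁻¹` for the first columns `e_k` of
Sprung's `𝒞_1⋯𝒞_k Ã⁻¹` (Sprung 2017, §4: `det 𝒞_i = Φ_{p^i}(1+T)`, `det Ã = 1`).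
[cite: Sprung2017, §4 Cor. 4.4 (the matrices 𝒞_i, Ã)] -/
theorem sharpPoly_succ_mul_flatPoly_sub (ap : ℤ) (n : ℕ) :
    sharpPoly ap p (n + 1) * flatPoly ap p n - flatPoly ap p (n + 1) * sharpPoly ap p n =
      ∏ i ∈ Finset.range n, (cyclotomic (p ^ (i + 1)) ℤ).comp (X + 1) := by
  induction n with
  | zero => simp
  | succ n ih =>
    rw [show n + 1 + 1 = n + 2 by ring, sharpPoly_add_two, flatPoly_add_two,
      Finset.prod_range_succ, ← ih]
    ring

/-- **The shifted Wronskians** `v_m u_{m+j} − u_m v_{m+j}` are multiples `Ω_m · w_j` of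
`Ω_m = ∏_{1≤i≤m} Φ_{p^i}(1+T)`, with `w_0 = 0`, `w_1 = 1` and
`w_{j+2} = a_p w_{j+1} − Φ_{p^{m+j+1}}(1+T) w_j` (a solution of the same recursion), hence
`w_j ∈ (p, T)^{⌊j/2⌋}` when `p ∣ a_p`. [cite: Sprung2017, §4 Cor. 4.4 and Proposition "𝔐 = 0"] -/
theorem exists_wronskian_eq_mul {ap : ℤ} (hap : (p : ℤ) ∣ ap) (m j : ℕ) :
    ∃ w : ℤ[X], flatPoly ap p m * sharpPoly ap p (m + j) - sharpPoly ap p m * flatPoly ap p (m + j) =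
        (∏ i ∈ Finset.range m, (cyclotomic (p ^ (i + 1)) ℤ).comp (X + 1)) * w ∧
      ∀ i, (p : ℤ_[p]) ^ (j / 2 - i) ∣ (w.map (Int.castRingHom ℤ_[p])).coeff i := by
  have hapZ : (p : ℤ_[p]) ∣ (ap : ℤ_[p]) := by
    obtain ⟨k, hk⟩ := hap
    exact ⟨(k : ℤ_[p]), by rw [hk]; push_cast; ring⟩
  set Ω : ℤ[X] := ∏ i ∈ Finset.range m, (cyclotomic (p ^ (i + 1)) ℤ).comp (X + 1) with hΩ
  -- joint induction on `j` and `j + 1`, carrying the witnesses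
  have key : ∀ j, ∃ w w' : ℤ[X],
      (flatPoly ap p m * sharpPoly ap p (m + j) - sharpPoly ap p m * flatPoly ap p (m + j) =
        Ω * w ∧ ∀ i, (p : ℤ_[p]) ^ (j / 2 - i) ∣ (w.map (Int.castRingHom ℤ_[p])).coeff i) ∧
      (flatPoly ap p m * sharpPoly ap p (m + (j + 1)) -
          sharpPoly ap p m * flatPoly ap p (m + (j + 1)) =
        Ω * w' ∧ ∀ i, (p : ℤ_[p]) ^ ((j + 1) / 2 - i) ∣ (w'.map (Int.castRingHom ℤ_[p])).coeff i) := by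
    intro j
    induction j with
    | zero =>
      refine ⟨0, 1, ⟨by rw [add_zero, mul_zero]; ring, fun i ↦ ?_⟩, ⟨?_, fun i ↦ ?_⟩⟩
      · rw [Polynomial.map_zero, coeff_zero]
        exact dvd_zero _
      · rw [mul_one, hΩ, ← sharpPoly_succ_mul_flatPoly_sub ap m]
        ring
      · rw [show (0 + 1) / 2 = 0 from rfl]
        exact pord_zero _ i
    | succ j ih =>
      obtain ⟨w, w', ⟨hw, hwo⟩, ⟨hw', hwo'⟩⟩ := ih
      refine ⟨w', C ap * w' - (cyclotomic (p ^ (m + j + 1)) ℤ).comp (X + 1) * w, ⟨hw', hwo'⟩,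
        ⟨?_, fun i ↦ ?_⟩⟩
      · rw [show m + (j + 1 + 1) = (m + j) + 2 by ring, sharpPoly_add_two, flatPoly_add_two,
          show m + j + 1 = m + (j + 1) by ring]
        linear_combination (C ap) * hw' - (cyclotomic (p ^ (m + (j + 1))) ℤ).comp (X + 1) * hw
      · rw [Polynomial.map_sub, Polynomial.map_mul, Polynomial.map_mul, Polynomial.map_C,
          eq_intCast]
        refine pord_sub (fun i ↦ ?_) (fun i ↦ ?_) i
        · exact pord_mono (by omega) (pord_mul (pord_C hapZ) hwo') i
        · have h := pord_mul (pord_cyclotomic (p := p) (m + j)) hwo i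
          rwa [show 1 + j / 2 = (j + 1 + 1) / 2 by omega] at h
  obtain ⟨w, -, h, -⟩ := key j
  exact ⟨w, h⟩

end Order

/-! ## §6. Coefficientwise limits in `Λ = ℤ_p⟦T⟧` -/

section Limits

open Filter _root_.Topology

variable {p : ℕ} [hp : Fact p.Prime]

/-- **Coefficientwise limits in `ℤ_p⟦T⟧` from `p`-adic divisibility of the steps**: if the
`i`-th coefficient of `P_{M+1} − P_M` is divisible by `p^{⌊M/2⌋ − K₀ − i}` for all `M, i`, then
`P_M` converges coefficientwise to a power series (`ℤ_p` is complete and ultrametric, and the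
exponents tend to `∞`) — the mechanism `Λ = lim Λ_n` of Lang, *Cyclotomic Fields I and II*,
Ch. 5 §1 Thm. 1.1, here along half-integral exponents. [cite: Lang1990, Ch. 5 §1 Thm. 1.1] -/
private theorem exists_powerSeries_tendsto_coeff_of_dvd (P : ℕ → ℤ_[p][X]) (K₀ : ℕ)
    (hP : ∀ M i, (p : ℤ_[p]) ^ (M / 2 - K₀ - i) ∣ (P (M + 1) - P M).coeff i) :
    ∃ L : PowerSeries ℤ_[p], ∀ i,
      Tendsto (fun M ↦ (P M).coeff i) atTop (𝓝 (PowerSeries.coeff i L)) := by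
  -- `p^{⌊M/2⌋ - K₀ - i} ∣ (P_{M+k} - P_M)_i`
  have hstep : ∀ M k i, (p : ℤ_[p]) ^ (M / 2 - K₀ - i) ∣ (P (M + k) - P M).coeff i := by
    intro M k i
    induction k with
    | zero =>
      rw [add_zero, sub_self, coeff_zero]
      exact dvd_zero _
    | succ k ih =>
      have h1 : P (M + (k + 1)) - P M = (P (M + k + 1) - P (M + k)) + (P (M + k) - P M) := by
        rw [← add_assoc]
        ring
      rw [h1, coeff_add]
      exact dvd_add ((pow_dvd_pow _ (by omega)).trans (hP (M + k) i)) ih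
  have hnorm : ∀ M k i, ‖(P (M + k)).coeff i - (P M).coeff i‖ ≤
      (p : ℝ) ^ (-((M / 2 - K₀ - i : ℕ) : ℤ)) := by
    intro M k i
    rw [← coeff_sub]
    exact (PadicInt.norm_le_pow_iff_mem_span_pow _ _).mpr
      (Ideal.mem_span_singleton.mpr (hstep M k i))
  have hcau : ∀ i, CauchySeq (fun M ↦ (P M).coeff i) := fun i ↦ by
    refine Metric.cauchySeq_iff'.mpr fun ε hε ↦ ?_
    obtain ⟨e, he⟩ := PadicInt.exists_pow_neg_lt p hε
    refine ⟨2 * (e + K₀ + i), fun n hn ↦ ?_⟩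
    obtain ⟨k, rfl⟩ := Nat.exists_eq_add_of_le hn
    rw [dist_eq_norm]
    refine (hnorm _ k i).trans_lt ?_
    rwa [show 2 * (e + K₀ + i) / 2 - K₀ - i = e by omega]
  choose l hl using fun i ↦ cauchySeq_tendsto_of_complete (hcau i)
  exact ⟨PowerSeries.mk l, fun i ↦ by rw [PowerSeries.coeff_mk]; exact hl i⟩

/-- Coefficientwise limits commute with multiplication by a fixed polynomial. [folklore] -/
private theorem tendsto_coeff_mul (D : ℤ_[p][X]) {P : ℕ → ℤ_[p][X]} {L : PowerSeries ℤ_[p]}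
    (h : ∀ j, Tendsto (fun M ↦ (P M).coeff j) atTop (𝓝 (PowerSeries.coeff j L))) (j : ℕ) :
    Tendsto (fun M ↦ (D * P M).coeff j) atTop
      (𝓝 (PowerSeries.coeff j ((D : PowerSeries ℤ_[p]) * L))) := by
  simp_rw [coeff_mul]
  rw [PowerSeries.coeff_mul]
  refine tendsto_finsetSum _ fun x _ ↦ ?_
  rw [Polynomial.coeff_coe]
  exact (h x.2).const_mul _

end Limits

/-! ## §7. Construction of `(L♯, L♭)` in `Λ²` -/

section Construction

open Filter _root_.Topology

variable {N : ℕ} [NeZero N] {f : CuspForm (Gamma0 N) 2} {p : ℕ} [Fact p.Prime]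

omit [NeZero N] in
/-- **Sprung's pair exists, integrally — from integral lifts satisfying the three-term relation**
(any prime `p`, `p ∣ a_p`): given `Θ_n ∈ ℤ_p[T]` lifting the `θ_n` with three-term quotients
`c_n ∈ ℤ_p[T]` (`Θ_{n+2} − a_p Θ_{n+1} + Φ_{p^{n+1}}(1+T) Θ_n = ω_{n+1} c_n`), there are
`L♯, L♭ ∈ Λ = ℤ_p⟦T⟧` with `θ_m + u_m L♯ + v_m L♭ ∈ ω_m Λ` for every `m ≥ 0`. This is the
`p`-UNIFORM part of the construction of `exists_integral_isSprungPair` (approximants `Y_n`,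
Wronskians, `(p,T)`-adic convergence — Sprung 2017, Cor. 4.4 / "Proposition (yeah)" `𝔐 = 0` /
Thm. 1.12), isolated so that the `p = 2` case (Sprung's shift `N = n + 2`, §1.1) only has to supply
the lifts. [cite: Sprung2017, Thm. 1.12, Cor. 4.4 and Cor. 4.10] -/
theorem exists_integral_isSprungPair_of_lifts {ap : ℤ} (hpa : (p : ℤ) ∣ ap)
    (hΘc : ∃ (Θ c : ℕ → ℤ_[p][X]),
      (∀ n, (Θ n).map (algebraMap ℤ_[p] ℚ_[p]) =
        (mazurTateElement f p n).map (algebraMap ℚ ℚ_[p])) ∧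
      ∀ n, Θ (n + 2) - C (ap : ℤ_[p]) * Θ (n + 1) +
          ((cyclotomic (p ^ (n + 1)) ℤ).comp (X + 1)).map (Int.castRingHom ℤ_[p]) * Θ n =
        (cyclotomicOmega p (n + 1)).map (Int.castRingHom ℤ_[p]) * c n) :
    ∃ Ls Lf : IwasawaAlgebra p, ∀ m : ℕ, ∃ Q : IwasawaAlgebra p,
      ((mazurTateElement f p m).map (algebraMap ℚ ℚ_[p]) : PowerSeries ℚ_[p]) +
          iwasawaToPowerSeries p
            (toIwasawa p (sharpPoly ap p m) * Ls + toIwasawa p (flatPoly ap p m) * Lf) =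
        iwasawaToPowerSeries p
          (((cyclotomicOmega p m).map (Int.castRingHom ℤ_[p]) : PowerSeries ℤ_[p]) * Q) := by
  classical
  obtain ⟨Θ, c, hΘ, hc⟩ := hΘc
  -- the recursion polynomials and the cyclotomic data over `ℤ_p`
  set U : ℕ → ℤ_[p][X] := fun n ↦ (sharpPoly ap p n).map (Int.castRingHom ℤ_[p]) with hU
  set V : ℕ → ℤ_[p][X] := fun n ↦ (flatPoly ap p n).map (Int.castRingHom ℤ_[p]) with hV
  set Φ : ℕ → ℤ_[p][X] := fun k ↦
    ((cyclotomic (p ^ k) ℤ).comp (X + 1)).map (Int.castRingHom ℤ_[p]) with hΦ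
  set Ω : ℕ → ℤ_[p][X] := fun n ↦
    (∏ i ∈ Finset.range n, (cyclotomic (p ^ (i + 1)) ℤ).comp (X + 1)).map (Int.castRingHom ℤ_[p])
    with hΩ
  set ω : ℕ → ℤ_[p][X] := fun n ↦ (cyclotomicOmega p n).map (Int.castRingHom ℤ_[p]) with hω
  have hU0 : U 0 = 0 := by simp [hU]
  have hU1 : U 1 = 1 := by simp [hU]
  have hV0 : V 0 = 1 := by simp [hV]
  have hV1 : V 1 = 0 := by simp [hV]
  have hU2 : ∀ n, U (n + 2) = C (ap : ℤ_[p]) * U (n + 1) - Φ (n + 1) * U n := fun n ↦ by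
    simp only [hU, hΦ]
    rw [sharpPoly_add_two, Polynomial.map_sub, Polynomial.map_mul, Polynomial.map_mul,
      Polynomial.map_C, eq_intCast]
  have hV2 : ∀ n, V (n + 2) = C (ap : ℤ_[p]) * V (n + 1) - Φ (n + 1) * V n := fun n ↦ by
    simp only [hV, hΦ]
    rw [flatPoly_add_two, Polynomial.map_sub, Polynomial.map_mul, Polynomial.map_mul,
      Polynomial.map_C, eq_intCast]
  have hωΩ : ∀ n, ω n = X * Ω n := fun n ↦ by
    simp only [hω, hΩ]
    rw [← X_mul_prod_cyclotomic_comp_eq_cyclotomicOmega, Polynomial.map_mul, Polynomial.map_X]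
  have hΩs : ∀ n, Ω (n + 1) = Ω n * Φ (n + 1) := fun n ↦ by
    simp only [hΩ, hΦ]
    rw [Finset.prod_range_succ, Polynomial.map_mul]
  have hdet : ∀ n, U (n + 1) * V n - V (n + 1) * U n = Ω n := fun n ↦ by
    simp only [hU, hV, hΩ]
    rw [← Polynomial.map_mul, ← Polynomial.map_mul, ← Polynomial.map_sub,
      sharpPoly_succ_mul_flatPoly_sub]
  have hc' : ∀ n, Θ (n + 2) - C (ap : ℤ_[p]) * Θ (n + 1) + Φ (n + 1) * Θ n =
      X * Ω (n + 1) * c n := fun n ↦ by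
    rw [← hωΩ]
    exact hc n
  -- orders: `u_n, v_n ∈ (p, T)^{⌊n/2⌋}`
  have hUord : ∀ n i, (p : ℤ_[p]) ^ (n / 2 - i) ∣ (U n).coeff i := fun n i ↦
    pow_dvd_coeff_map_sprungSeq hpa 0 1 n i
  have hVord : ∀ n i, (p : ℤ_[p]) ^ (n / 2 - i) ∣ (V n).coeff i := fun n i ↦
    pow_dvd_coeff_map_sprungSeq hpa 1 0 n i
  -- the shifted Wronskians `V m * U (m + j) - U m * V (m + j) = Ω m * W m j`
  choose w hw hwo using fun m j ↦ exists_wronskian_eq_mul (p := p) hpa m j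
  set W : ℕ → ℕ → ℤ_[p][X] := fun m j ↦ (w m j).map (Int.castRingHom ℤ_[p]) with hW
  have hWr : ∀ m j, V m * U (m + j) - U m * V (m + j) = Ω m * W m j := fun m j ↦ by
    simp only [hU, hV, hΩ, hW]
    rw [← Polynomial.map_mul, ← Polynomial.map_mul, ← Polynomial.map_sub, hw,
      Polynomial.map_mul]
  -- the approximants `Y_n = (Θ_1, Θ_0) + T ∑_{k<n} c_k (v_{k+1}, -u_{k+1})`
  set Y₁ : ℕ → ℤ_[p][X] := fun n ↦ Θ 1 + X * ∑ k ∈ Finset.range n, c k * V (k + 1) with hY₁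
  set Y₂ : ℕ → ℤ_[p][X] := fun n ↦ Θ 0 - X * ∑ k ∈ Finset.range n, c k * U (k + 1) with hY₂
  have hY₁s : ∀ n, Y₁ (n + 1) = Y₁ n + X * (c n * V (n + 1)) := fun n ↦ by
    simp only [hY₁, Finset.sum_range_succ]
    ring
  have hY₂s : ∀ n, Y₂ (n + 1) = Y₂ n - X * (c n * U (n + 1)) := fun n ↦ by
    simp only [hY₂, Finset.sum_range_succ]
    ring
  -- Claim A: `Y_n · e_{n+1} = Θ_{n+1}` and `Y_n · e_n = Θ_n`, exactly
  have hA : ∀ n, U (n + 1) * Y₁ n + V (n + 1) * Y₂ n = Θ (n + 1) ∧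
      U n * Y₁ n + V n * Y₂ n = Θ n := by
    intro n
    induction n with
    | zero =>
      simp only [hY₁, hY₂, Finset.sum_range_zero, mul_zero, add_zero, sub_zero, hU0, hU1, hV0,
        hV1]
      constructor <;> ring
    | succ n ih =>
      obtain ⟨ih1, ih2⟩ := ih
      refine ⟨?_, ?_⟩
      · have h3 := hc' n
        rw [hΩs] at h3
        have hd := hdet n
        rw [show n + 1 + 1 = n + 2 by ring, hY₁s, hY₂s, hU2, hV2]
        linear_combination (C (ap : ℤ_[p])) * ih1 - Φ (n + 1) * ih2 +
          X * c n * Φ (n + 1) * hd - h3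
      · rw [hY₁s, hY₂s]
        linear_combination ih1
  -- Claim B: `Y_{m+M} · e_m = Θ_m - ω_m G_m(M)` with `G_m(M) = ∑_{k<M} c_{m+k} W_m(k+1)`
  set G : ℕ → ℕ → ℤ_[p][X] := fun m M ↦ ∑ k ∈ Finset.range M, c (m + k) * W m (k + 1) with hG
  have hGs : ∀ m M, G m (M + 1) = G m M + c (m + M) * W m (M + 1) := fun m M ↦ by
    simp only [hG, Finset.sum_range_succ]
  have hB : ∀ m M, U m * Y₁ (m + M) + V m * Y₂ (m + M) = Θ m - ω m * G m M := by
    intro m M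
    induction M with
    | zero =>
      simp only [hG, Finset.sum_range_zero, mul_zero, sub_zero, add_zero]
      exact (hA m).2
    | succ M ih =>
      have hWm := hWr m (M + 1)
      rw [show m + (M + 1) = m + M + 1 by ring, hY₁s, hY₂s, hGs, hωΩ]
      rw [show m + (M + 1) = m + M + 1 by ring] at hWm
      linear_combination ih - X * c (m + M) * hWm - G m M * hωΩ m
  -- convergence of `Y₁`, `Y₂` and of the `G_m`
  have hY₁c : ∀ M i, (p : ℤ_[p]) ^ (M / 2 - 0 - i) ∣ (Y₁ (M + 1) - Y₁ M).coeff i := by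
    intro M i
    rw [hY₁s, add_sub_cancel_left, Nat.sub_zero]
    exact pord_mono (by omega) (pord_mul_left X (pord_mul_left (c M) (hVord (M + 1)))) i
  have hY₂c : ∀ M i, (p : ℤ_[p]) ^ (M / 2 - 0 - i) ∣ (Y₂ (M + 1) - Y₂ M).coeff i := by
    intro M i
    rw [hY₂s, sub_sub_cancel_left, coeff_neg, dvd_neg, Nat.sub_zero]
    exact pord_mono (by omega) (pord_mul_left X (pord_mul_left (c M) (hUord (M + 1)))) i
  have hGc : ∀ m M i, (p : ℤ_[p]) ^ (M / 2 - 0 - i) ∣ (G m (M + 1) - G m M).coeff i := by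
    intro m M i
    rw [hGs, add_sub_cancel_left, Nat.sub_zero]
    exact pord_mono (by omega) (pord_mul_left (c (m + M)) (hwo m (M + 1))) i
  obtain ⟨y₁, hy₁⟩ := exists_powerSeries_tendsto_coeff_of_dvd Y₁ 0 hY₁c
  obtain ⟨y₂, hy₂⟩ := exists_powerSeries_tendsto_coeff_of_dvd Y₂ 0 hY₂c
  have hq : ∀ m, ∃ Q : PowerSeries ℤ_[p],
      (U m : PowerSeries ℤ_[p]) * y₁ + (V m : PowerSeries ℤ_[p]) * y₂ =
        (Θ m : PowerSeries ℤ_[p]) - (ω m : PowerSeries ℤ_[p]) * Q := by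
    intro m
    obtain ⟨Q, hQ⟩ := exists_powerSeries_tendsto_coeff_of_dvd (G m) 0 (hGc m)
    refine ⟨Q, PowerSeries.ext fun i ↦ ?_⟩
    -- both sides are limits of the `i`-th coefficient of Claim B along `M ↦ m + M`
    have hshift : ∀ (Y : ℕ → ℤ_[p][X]) (y : PowerSeries ℤ_[p]),
        (∀ j, Tendsto (fun M ↦ (Y M).coeff j) atTop (𝓝 (PowerSeries.coeff j y))) →
        ∀ j, Tendsto (fun M ↦ (Y (m + M)).coeff j) atTop (𝓝 (PowerSeries.coeff j y)) := by
      intro Y y hY j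
      have h3 : (fun M ↦ (Y (m + M)).coeff j) = fun M ↦ (fun n ↦ (Y n).coeff j) (M + m) := by
        ext M
        rw [add_comm]
      rw [h3]
      exact (tendsto_add_atTop_iff_nat m).mpr (hY j)
    have h1 : Tendsto (fun M ↦ (U m * Y₁ (m + M) + V m * Y₂ (m + M)).coeff i) atTop
        (𝓝 (PowerSeries.coeff i ((U m : PowerSeries ℤ_[p]) * y₁ + (V m : PowerSeries ℤ_[p]) * y₂))) := by
      simp_rw [coeff_add]
      rw [map_add]
      exact (tendsto_coeff_mul (U m) (hshift Y₁ y₁ hy₁) i).add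
        (tendsto_coeff_mul (V m) (hshift Y₂ y₂ hy₂) i)
    have h2 : Tendsto (fun M ↦ (U m * Y₁ (m + M) + V m * Y₂ (m + M)).coeff i) atTop
        (𝓝 (PowerSeries.coeff i ((Θ m : PowerSeries ℤ_[p]) - (ω m : PowerSeries ℤ_[p]) * Q))) := by
      simp_rw [hB, coeff_sub]
      rw [map_sub, Polynomial.coeff_coe]
      exact tendsto_const_nhds.sub (tendsto_coeff_mul (ω m) hQ i)
    exact tendsto_nhds_unique h1 h2
  -- `(L♯, L♭) = -lim Y`
  refine ⟨-y₁, -y₂, fun m ↦ ?_⟩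
  obtain ⟨Q, hQm⟩ := hq m
  refine ⟨Q, ?_⟩
  have hθ : (((mazurTateElement f p m).map (algebraMap ℚ ℚ_[p]) : ℚ_[p][X]) :
      PowerSeries ℚ_[p]) = iwasawaToPowerSeries p (Θ m : PowerSeries ℤ_[p]) := by
    rw [← hΘ, Polynomial.polynomial_map_coe]
  have htoI : ∀ q : ℤ[X], toIwasawa p q =
      ((q.map (Int.castRingHom ℤ_[p]) : ℤ_[p][X]) : PowerSeries ℤ_[p]) := fun q ↦ rfl
  have key : (Θ m : PowerSeries ℤ_[p]) +
      (toIwasawa p (sharpPoly ap p m) * -y₁ + toIwasawa p (flatPoly ap p m) * -y₂) =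
        ((cyclotomicOmega p m).map (Int.castRingHom ℤ_[p]) : PowerSeries ℤ_[p]) * Q := by
    rw [htoI, htoI]
    change (Θ m : PowerSeries ℤ_[p]) + ((U m : PowerSeries ℤ_[p]) * -y₁ +
      (V m : PowerSeries ℤ_[p]) * -y₂) = (ω m : PowerSeries ℤ_[p]) * Q
    linear_combination (-1 : PowerSeries ℤ_[p]) * hQm
  rw [hθ, ← map_add, key]

/-- **Sprung's pair exists, integrally** (Sprung 2017, Cor. 4.4 / Thm. 1.12 in Mazur–Tate form,
with the integrality of Cor. 4.10): for `p` odd, `f` rational of level `N`, `p ∤ N` and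
`a_p(f) = a_p` with `p ∣ a_p`, there are `L♯, L♭ ∈ Λ = ℤ_p⟦T⟧` such that for every `m ≥ 0`
`θ_m + u_m L♯ + v_m L♭ ∈ ω_m Λ` (an identity in `ℚ_p⟦T⟧` through `ι : Λ ↪ ℚ_p⟦T⟧`, WITHOUT
inverting `p`). Construction: lift the `θ_n` to `Θ_n ∈ ℤ_p[T]` (`exists_lifts_threeTerm`, with
the three-term quotients `c_n`), put `Y_n = (Θ_1, Θ_0) + T ∑_{k<n} c_k (v_{k+1}, −u_{k+1})`; the
Wronskian identity `u_{k+1} v_k − v_{k+1} u_k = ω_k/T` gives `Y_n · (u_{n+1}, v_{n+1}) = Θ_{n+1}`,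
`Y_n · (u_n, v_n) = Θ_n` exactly (the matrix identity `(Θ_n, νΘ_{n−1}) = Υ_n 𝒞_1⋯𝒞_n Ã⁻¹` of
Cor. 4.4), and `Y_{m+M} · (u_m, v_m) = Θ_m − ω_m G_M` with `G_{M+1} − G_M = c_{m+M} w_{M+1}`
(shifted Wronskians); since `u_n, v_n, w_n ∈ (p,T)^{⌊n/2⌋}` (`p ∣ a_p`: Sprung's `𝔐 = 0`), `Y_n`
and `G_M` converge coefficientwise in `Λ`, and `(L♯, L♭) = −lim Y_n`.
[cite: Sprung2017, Thm. 1.12, Cor. 4.4 and Cor. 4.10] -/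
theorem exists_integral_isSprungPair (hp2 : p ≠ 2) (hf0 : IsNewform0 f) (hQ : coeffField f = ⊥)
    (hpN : ¬ p ∣ N) {ap : ℤ} (hap : cuspCoeff f p = ap) (hpa : (p : ℤ) ∣ ap) :
    ∃ Ls Lf : IwasawaAlgebra p, ∀ m : ℕ, ∃ Q : IwasawaAlgebra p,
      ((mazurTateElement f p m).map (algebraMap ℚ ℚ_[p]) : PowerSeries ℚ_[p]) +
          iwasawaToPowerSeries p
            (toIwasawa p (sharpPoly ap p m) * Ls + toIwasawa p (flatPoly ap p m) * Lf) =
        iwasawaToPowerSeries p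
          (((cyclotomicOmega p m).map (Int.castRingHom ℤ_[p]) : PowerSeries ℤ_[p]) * Q) := by
  have hprime : p.Prime := Fact.out
  -- `a_p ≢ 1 (mod p)` since `p ∣ a_p`
  have hpa1 : ¬ (p : ℤ) ∣ ap - 1 := by
    intro h
    have h1 : (p : ℤ) ∣ 1 := by
      have h2 := dvd_sub hpa h
      rwa [sub_sub_cancel] at h2
    exact hprime.ne_one (by exact_mod_cast Int.eq_one_of_dvd_one (by positivity) h1)
  exact exists_integral_isSprungPair_of_lifts hpa (exists_lifts_threeTerm hp2 hf0 hQ hpN hap hpa1)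

end Construction

/-! ## §8. The named fact -/

section Holds

variable {W : WeierstrassCurve ℚ} [W.IsElliptic] [W.IsGloballyMinimal] {N : ℕ} [NeZero N]
  {f : CuspForm (Gamma0 N) 2} {p : ℕ} [Fact p.Prime]

/-- **Sprung 2017, Theorem 1.12 (supersingular case) in Mazur–Tate form — the named fact
`thm112_exists_isSprungPair` is a THEOREM of the tree**: for `p ≠ 2`, `f` the newform of
`E = W` (`IsNewformOf W f`), `E` with good reduction at `p` and `p ∣ a_p(E)`, there exist
`L♯, L♭ ∈ Λ = ℤ_p⟦T⟧` with `θ_n ≡ −(u_n L♯ + v_n L♭) (mod ω_n)` for all `n`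
(`IsSprungPair f p (a_p(E)) L♯ L♭`; in fact integrally, exponent `m = 0` in `IsCongrModOmega`).
Assembly: `p ∤ N` (`not_dvd_level_of_isNewformOf`), `a_p(f) = a_p(E)`
(`cuspCoeff_eq_frobeniusTrace_of_isNewformOf_holds`), and `exists_integral_isSprungPair`.
Net effect: debt −1 (the users `Summit.….Supersingular.*` of the fact become unconditional by
feeding `thm112_exists_isSprungPair_holds`; at `a_p = 0` this re-proves the congruence half of
`pollack_exists_plusMinusPAdicLFunction` by a second route).
[cite: Sprung2017, Thm. 1.12, Cor. 4.4, Cor. 4.5, Cor. 4.10 and Cor. 4.11] -/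
theorem thm112_exists_isSprungPair_holds :
    thm112_exists_isSprungPair (W := W) (f := f) (p := p) := by
  intro hp2 hf hgood hap
  have hf0 : IsNewform0 f := hf.1
  have hQ : coeffField f = ⊥ := hf.coeffField_eq_bot
  have hpN : ¬ p ∣ N := not_dvd_level_of_isNewformOf hf hgood
  have hap' : cuspCoeff f p = ((W.frobeniusTrace p : ℤ) : ℂ) :=
    cuspCoeff_eq_frobeniusTrace_of_isNewformOf_holds hf hgood
  obtain ⟨Ls, Lf, h⟩ := exists_integral_isSprungPair hp2 hf0 hQ hpN hap' hap
  refine ⟨Ls, Lf, fun m ↦ ?_⟩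
  obtain ⟨Q, hQm⟩ := h m
  refine ⟨0, Q, ?_⟩
  rw [pow_zero, map_one, one_mul, Polynomial.map_neg, Polynomial.map_one, Polynomial.coe_neg,
    Polynomial.coe_one, neg_one_mul, map_neg, sub_neg_eq_add, hQm]

end Holds

end Literature.NumberTheory.EllipticCurves.Sprung2017

end
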